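import Literature.NumberTheory.Automorphic.StandardTestFunGaussian
import Literature.NumberTheory.Automorphic.RankinSelbergTorusIntegral
import HarnessLib

/-!
# Thin Rankin–Selberg test functions `Φ_∞ ⊗ ⊗_{v ∈ T} 𝟙_{e_n + 𝔭_v^m 𝒪_vⁿ} ⊗ 𝟙_{𝒪̂ⁿ}`

Topic `NumberTheory/Automorphic`; namespace `Literature.NumberTheory.Automorphic`. Groundwork for the
finite-place half of the named fact `JacquetShalika1981_partialPairL_pole_of_eq_conj`
(`PairLFunctionPoles`; Arthur–Clozel (1989), Ch. 3 (2.3)) in every rank. In the unfolded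
Rankin–Selberg integral `Ψ(s; W, W̄, Φ) = ∫_{N \ GL_n} |W(g)|² Φ(e_n g) |det g|^s dg` the Schwartz–Bruhat
function `Φ` may be chosen freely at the finitely many bad places (Jacquet–Shalika (1981), §4 and (5.1):
`Φ` is prescribed only at the unramified places; Jacquet–Piatetski-Shapiro–Shalika (1983), (2.7): at a
non-archimedean place `Φ_v` supported near `e_n` makes the local integral a `P_n`-integral). This file
provides the **thin test function**

  `thinTestFun n K Φ_∞ T m (y) = Φ_∞(y_∞) · 𝟙[y_f ∈ 𝒪̂ⁿ and y_v ≡ e_n (mod 𝔭_v^m) for v ∈ T]`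

for a finite set `T` of finite places and a depth `m`, together with exactly the properties of the
standard test function `standardTestFun n K Φ_∞ = thinTestFun n K Φ_∞ ∅ m` that the global machinery
consumes: non-negativity, continuity, membership in `piSchwartzBruhat` (a pure tensor of a Schwartz
function and the indicator of a compact open set), positivity of `∫ Φ`, integrality of the rows in its
support, sphericality `IsLastRowSphericalAt` at the places off `T`, and the congruence it imposes at the
places of `T`. All proofs complete; no named fact.

## References

* H. Jacquet, J. A. Shalika, *On Euler products and the classification of automorphic
  representations I*, Amer. J. Math. 103 (1981), §4, (5.1) [JacquetShalikaAJM1981].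
* H. Jacquet, I. I. Piatetski-Shapiro, J. A. Shalika, *Rankin–Selberg convolutions*, Amer. J. Math.
  105 (1983), §2, (2.7) [JacquetPiatetskiShapiroShalika1983].
-/

noncomputable section

open scoped NNReal Classical
open NumberField NumberField.mixedEmbedding IsDedekindDomain Set MeasureTheory WithZero

namespace Literature.NumberTheory.Automorphic

section Thin

variable (n : ℕ) (K : Type) [Field K] [NumberField K]

/-- The **thin finite-adelic box** `{z ∈ 𝒪̂ⁿ | z_v ≡ e_n (mod 𝔭_v^m) for all v ∈ T}` of `(𝔸_K^∞)ⁿ`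
(`e_n = (0, …, 0, 1)` as in `lastBasisVec`). [folklore] -/
def thinFiniteBox (T : Finset (HeightOneSpectrum (𝓞 K))) (m : ℕ) : Set (Fin n → FiniteAdeleRing (𝓞 K) K) :=
  {z | (∀ (i : Fin n) (w : HeightOneSpectrum (𝓞 K)), z i w ∈ w.adicCompletionIntegers K) ∧
    ∀ w ∈ T, ∀ i : Fin n,
      Valued.v (z i w - if (i : ℕ) + 1 = n then 1 else 0) ≤ exp (-(m : ℤ))}

/-- The **thin test function** `Φ(y) = Φ_∞(y_∞) · 𝟙_{thinFiniteBox T m}(y_f)` on `𝔸_Kⁿ`. For `T = ∅`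
this is the standard test function `standardTestFun n K Φ_∞` (`thinTestFun_empty`).
[folklore] -/
def thinTestFun (Φinf : (Fin n → InfiniteAdeleRing K) → ℝ) (T : Finset (HeightOneSpectrum (𝓞 K))) (m : ℕ)
    (y : Fin n → AdeleRing (𝓞 K) K) : ℝ :=
  if (fun i => (y i).2) ∈ thinFiniteBox n K T m then Φinf (fun i => (y i).1) else 0

variable {n K}

/-- Unfolding of membership in the thin box. [folklore] -/
theorem mem_thinFiniteBox_iff {T : Finset (HeightOneSpectrum (𝓞 K))} {m : ℕ}
    {z : Fin n → FiniteAdeleRing (𝓞 K) K} :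
    z ∈ thinFiniteBox n K T m ↔
      (∀ (i : Fin n) (w : HeightOneSpectrum (𝓞 K)), z i w ∈ w.adicCompletionIntegers K) ∧
        ∀ w ∈ T, ∀ i : Fin n,
          Valued.v (z i w - if (i : ℕ) + 1 = n then 1 else 0) ≤ exp (-(m : ℤ)) :=
  Iff.rfl

/-- For `T = ∅` the thin test function is the standard one. [folklore] -/
theorem thinTestFun_empty (Φinf : (Fin n → InfiniteAdeleRing K) → ℝ) (m : ℕ) :
    thinTestFun n K Φinf ∅ m = standardTestFun n K Φinf := by
  funext y
  unfold thinTestFun standardTestFun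
  simp [mem_thinFiniteBox_iff]

/-- The thin test function is non-negative if `Φ_∞` is. [folklore] -/
theorem thinTestFun_nonneg {Φinf : (Fin n → InfiniteAdeleRing K) → ℝ} (h : ∀ z, 0 ≤ Φinf z)
    (T : Finset (HeightOneSpectrum (𝓞 K))) (m : ℕ) (y : Fin n → AdeleRing (𝓞 K) K) :
    0 ≤ thinTestFun n K Φinf T m y := by
  unfold thinTestFun
  split_ifs
  · exact h _
  · exact le_rfl

/-- The thin test function is bounded by `Φ_∞(y_∞)` if `Φ_∞ ≥ 0`. [folklore] -/
theorem thinTestFun_le {Φinf : (Fin n → InfiniteAdeleRing K) → ℝ} (h : ∀ z, 0 ≤ Φinf z)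
    (T : Finset (HeightOneSpectrum (𝓞 K))) (m : ℕ) (y : Fin n → AdeleRing (𝓞 K) K) :
    thinTestFun n K Φinf T m y ≤ Φinf (fun i => (y i).1) := by
  unfold thinTestFun
  split_ifs
  · exact le_rfl
  · exact h _

/-- **Rows in the support of the thin test function are integral at every finite place.** [folklore] -/
theorem thinTestFun_ne_zero_valued_le_one {Φinf : (Fin n → InfiniteAdeleRing K) → ℝ}
    {T : Finset (HeightOneSpectrum (𝓞 K))} {m : ℕ} {y : Fin n → AdeleRing (𝓞 K) K}
    (hy : thinTestFun n K Φinf T m y ≠ 0) (i : Fin n) (w : HeightOneSpectrum (𝓞 K)) :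
    Valued.v ((y i).2 w) ≤ 1 := by
  unfold thinTestFun at hy
  split_ifs at hy with h
  · exact (HeightOneSpectrum.mem_adicCompletionIntegers (R := 𝓞 K) K w).1 (h.1 i w)
  · exact absurd rfl hy

/-- **The congruence at the thin places**: if `Φ(y) ≠ 0` then `y_v ≡ e_n (mod 𝔭_v^m)` for `v ∈ T`.
[folklore] -/
theorem thinTestFun_ne_zero_valued_sub_le {Φinf : (Fin n → InfiniteAdeleRing K) → ℝ}
    {T : Finset (HeightOneSpectrum (𝓞 K))} {m : ℕ} {y : Fin n → AdeleRing (𝓞 K) K}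
    (hy : thinTestFun n K Φinf T m y ≠ 0) {v : HeightOneSpectrum (𝓞 K)} (hv : v ∈ T) (i : Fin n) :
    Valued.v ((y i).2 v - if (i : ℕ) + 1 = n then 1 else 0) ≤ exp (-(m : ℤ)) := by
  unfold thinTestFun at hy
  split_ifs at hy with h
  · exact h.2 v hv i
  · exact absurd rfl hy

/-- The thin test function equals `Φ_∞(y_∞)` on its box. [folklore] -/
theorem thinTestFun_of_mem {Φinf : (Fin n → InfiniteAdeleRing K) → ℝ}
    {T : Finset (HeightOneSpectrum (𝓞 K))} {m : ℕ} {y : Fin n → AdeleRing (𝓞 K) K}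
    (hy : (fun i => (y i).2) ∈ thinFiniteBox n K T m) :
    thinTestFun n K Φinf T m y = Φinf (fun i => (y i).1) := by
  unfold thinTestFun
  rw [if_pos hy]

/-! ### Topology of the thin box -/

/-- A closed ball `{x | |x|_v ≤ c}`, `c ≠ 0`, of `K_v` is clopen (Mathlib `Valued.isClopen_closedBall`,
after writing `c = |a|_v` by surjectivity of the valuation). [folklore] -/
private theorem isClopen_setOf_valued_le (v : HeightOneSpectrum (𝓞 K)) {c : ℤᵐ⁰} (hc : c ≠ 0) :
    IsClopen {x : v.adicCompletion K | Valued.v x ≤ c} := by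
  obtain ⟨z, hz⟩ := v.valuation_surjective K c
  have hz' : Valued.v (z : v.adicCompletion K) = c := by
    rw [HeightOneSpectrum.valuedAdicCompletion_eq_valuation', hz]
  have hne : Valued.v.restrict (z : v.adicCompletion K) ≠ 0 := by
    rw [Ne, Valuation.restrict_eq_zero_iff, hz']
    exact hc
  have h := Valued.isClopen_closedBall (v.adicCompletion K) hne
  simp only [Valuation.restrict_le_iff, hz'] at h
  exact h

variable (n K)

/-- The thin box is contained in `𝒪̂ⁿ`. [folklore] -/
theorem thinFiniteBox_subset (T : Finset (HeightOneSpectrum (𝓞 K))) (m : ℕ) :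
    thinFiniteBox n K T m ⊆ {z : Fin n → FiniteAdeleRing (𝓞 K) K |
      ∀ (i : Fin n) (w : HeightOneSpectrum (𝓞 K)), z i w ∈ w.adicCompletionIntegers K} :=
  fun _ hz => hz.1

/-- **The thin box is compact open** (clopen: `𝒪̂ⁿ` is clopen and the finitely many congruence
conditions are clopen conditions on continuous coordinates). [folklore] -/
theorem isClopen_thinFiniteBox (T : Finset (HeightOneSpectrum (𝓞 K))) (m : ℕ) :
    IsClopen (thinFiniteBox n K T m) := by
  have h1 : IsClopen {z : Fin n → FiniteAdeleRing (𝓞 K) K |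
      ∀ (i : Fin n) (w : HeightOneSpectrum (𝓞 K)), z i w ∈ w.adicCompletionIntegers K} :=
    isClopen_integralFiniteAdeleVec n K
  have h2 : IsClopen {z : Fin n → FiniteAdeleRing (𝓞 K) K | ∀ w ∈ T, ∀ i : Fin n,
      Valued.v (z i w - if (i : ℕ) + 1 = n then 1 else 0) ≤ exp (-(m : ℤ))} := by
    have hset : {z : Fin n → FiniteAdeleRing (𝓞 K) K | ∀ w ∈ T, ∀ i : Fin n,
        Valued.v (z i w - if (i : ℕ) + 1 = n then 1 else 0) ≤ exp (-(m : ℤ))} =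
        ⋂ w ∈ T, ⋂ i : Fin n, (fun z : Fin n → FiniteAdeleRing (𝓞 K) K =>
          z i w - if (i : ℕ) + 1 = n then 1 else 0) ⁻¹' {x | Valued.v x ≤ exp (-(m : ℤ))} := by
      ext z
      simp only [Set.mem_setOf_eq, Set.mem_iInter, Set.mem_preimage]
    rw [hset]
    refine T.finite_toSet.isClopen_biInter fun w _ => isClopen_iInter_of_finite fun i => ?_
    refine (isClopen_setOf_valued_le w (exp_ne_zero)).preimage ?_
    exact ((RestrictedProduct.continuous_eval w).comp (continuous_apply i)).sub continuous_const
  have heq : thinFiniteBox n K T m = {z : Fin n → FiniteAdeleRing (𝓞 K) K |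
      ∀ (i : Fin n) (w : HeightOneSpectrum (𝓞 K)), z i w ∈ w.adicCompletionIntegers K} ∩
      {z : Fin n → FiniteAdeleRing (𝓞 K) K | ∀ w ∈ T, ∀ i : Fin n,
        Valued.v (z i w - if (i : ℕ) + 1 = n then 1 else 0) ≤ exp (-(m : ℤ))} := rfl
  rw [heq]
  exact h1.inter h2

/-- The thin box is compact. [folklore] -/
theorem isCompact_thinFiniteBox (T : Finset (HeightOneSpectrum (𝓞 K))) (m : ℕ) :
    IsCompact (thinFiniteBox n K T m) :=
  (isCompact_integralFiniteAdeleVec n K).of_isClosed_subset (isClopen_thinFiniteBox n K T m).isClosed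
    (thinFiniteBox_subset n K T m)

/-- `e_n ∈` the thin box. [folklore] -/
theorem lastBasisVec_mem_thinFiniteBox (T : Finset (HeightOneSpectrum (𝓞 K))) (m : ℕ) :
    (fun i : Fin n => ((if (i : ℕ) + 1 = n then 1 else 0 : FiniteAdeleRing (𝓞 K) K))) ∈
      thinFiniteBox n K T m := by
  refine ⟨fun i w => ?_, fun w _ i => ?_⟩
  · change ((if (i : ℕ) + 1 = n then 1 else 0 : FiniteAdeleRing (𝓞 K) K)) w ∈ _
    by_cases h : (i : ℕ) + 1 = n
    · rw [if_pos h]; exact one_mem _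
    · rw [if_neg h]; exact zero_mem _
  · have : ((if (i : ℕ) + 1 = n then 1 else 0 : FiniteAdeleRing (𝓞 K) K)) w =
        if (i : ℕ) + 1 = n then 1 else 0 := by
      split_ifs <;> rfl
    rw [this, sub_self, Valuation.map_zero]
    exact zero_le

/-- **`𝟙_{thin box}` is a Schwartz–Bruhat function on `(𝔸_K^∞)ⁿ`.** [folklore] -/
theorem indicator_thinFiniteBox_mem_schwartzBruhat (T : Finset (HeightOneSpectrum (𝓞 K))) (m : ℕ) :
    (thinFiniteBox n K T m).indicator (1 : (Fin n → FiniteAdeleRing (𝓞 K) K) → ℂ) ∈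
      SchwartzBruhat (Fin n → FiniteAdeleRing (𝓞 K) K) := by
  have hUc : IsClopen (thinFiniteBox n K T m) := isClopen_thinFiniteBox n K T m
  rw [mem_schwartzBruhat_iff]
  constructor
  · rw [IsLocallyConstant.iff_exists_open]
    intro y
    by_cases hy : y ∈ thinFiniteBox n K T m
    · exact ⟨_, hUc.isOpen, hy, fun z hz => by
        simp only [Set.indicator_of_mem hz, Set.indicator_of_mem hy, Pi.one_apply]⟩
    · exact ⟨_, hUc.compl.isOpen, hy, fun z hz => by
        rw [Set.indicator_of_notMem hz, Set.indicator_of_notMem hy]⟩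
  · exact HasCompactSupport.intro (isCompact_thinFiniteBox n K T m) fun y hy => Set.indicator_of_notMem hy _

variable {n K}

/-- `(Φ y : ℂ) = Ψ(y_∞) · 𝟙_{thin box}(y_f)` when `(Φ_∞ z : ℂ) = Ψ(e(z))`. [folklore] -/
theorem ofReal_thinTestFun_eq_tensor {Φinf : (Fin n → InfiniteAdeleRing K) → ℝ}
    {Ψ : SchwartzMap (Fin n → mixedSpace K) ℂ}
    (hΦinf : ∀ z : Fin n → InfiniteAdeleRing K,
      ((Φinf z : ℝ) : ℂ) = Ψ fun i => InfiniteAdeleRing.ringEquiv_mixedSpace K (z i))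
    (T : Finset (HeightOneSpectrum (𝓞 K))) (m : ℕ) (y : Fin n → AdeleRing (𝓞 K) K) :
    ((thinTestFun n K Φinf T m y : ℝ) : ℂ) =
      Ψ (piArch K (Fin n) y) * (thinFiniteBox n K T m).indicator
        (1 : (Fin n → FiniteAdeleRing (𝓞 K) K) → ℂ) (piFinite K (Fin n) y) := by
  unfold thinTestFun
  by_cases h : (fun i => (y i).2) ∈ thinFiniteBox n K T m
  · have hmem : piFinite K (Fin n) y ∈ thinFiniteBox n K T m := h
    rw [if_pos h, hΦinf, Set.indicator_of_mem hmem, Pi.one_apply, mul_one]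
    rfl
  · have hmem : piFinite K (Fin n) y ∉ thinFiniteBox n K T m := h
    rw [if_neg h, Set.indicator_of_notMem hmem, mul_zero, Complex.ofReal_zero]

/-- **The thin test function lies in `piSchwartzBruhat K (Fin n)`** whenever `Φ_∞` is a Schwartz
function of `z_∞`. [folklore] -/
theorem ofReal_thinTestFun_mem_piSchwartzBruhat {Φinf : (Fin n → InfiniteAdeleRing K) → ℝ}
    {Ψ : SchwartzMap (Fin n → mixedSpace K) ℂ}
    (hΦinf : ∀ z : Fin n → InfiniteAdeleRing K,
      ((Φinf z : ℝ) : ℂ) = Ψ fun i => InfiniteAdeleRing.ringEquiv_mixedSpace K (z i))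
    (T : Finset (HeightOneSpectrum (𝓞 K))) (m : ℕ) :
    (fun y => ((thinTestFun n K Φinf T m y : ℝ) : ℂ)) ∈ piSchwartzBruhat K (Fin n) := by
  have heq : (fun y => ((thinTestFun n K Φinf T m y : ℝ) : ℂ)) = fun y =>
      Ψ (piArch K (Fin n) y) * (thinFiniteBox n K T m).indicator
        (1 : (Fin n → FiniteAdeleRing (𝓞 K) K) → ℂ) (piFinite K (Fin n) y) :=
    funext (ofReal_thinTestFun_eq_tensor hΦinf T m)
  rw [heq]
  exact tensor_mem_piSchwartzBruhat Ψ (indicator_thinFiniteBox_mem_schwartzBruhat n K T m)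

/-- **Continuity of the thin test function** for continuous `Φ_∞`. [folklore] -/
theorem continuous_thinTestFun_of_continuous {Φinf : (Fin n → InfiniteAdeleRing K) → ℝ}
    (hΦ : Continuous Φinf) (T : Finset (HeightOneSpectrum (𝓞 K))) (m : ℕ) :
    Continuous (thinTestFun n K Φinf T m) := by
  have hU : IsClopen {y : Fin n → AdeleRing (𝓞 K) K | (fun i => (y i).2) ∈ thinFiniteBox n K T m} :=
    (isClopen_thinFiniteBox n K T m).preimage (continuous_pi fun i => continuous_snd.comp (continuous_apply i))
  have hf : Continuous fun y : Fin n → AdeleRing (𝓞 K) K => Φinf fun i => (y i).1 :=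
    hΦ.comp (continuous_pi fun i => continuous_fst.comp (continuous_apply i))
  have heq : thinTestFun n K Φinf T m =
      {y : Fin n → AdeleRing (𝓞 K) K | (fun i => (y i).2) ∈ thinFiniteBox n K T m}.indicator
        fun y => Φinf fun i => (y i).1 := by
    funext y
    unfold thinTestFun
    rw [Set.indicator_apply]
    rfl
  rw [heq]
  exact hU.continuous_indicator hf

/-- **The thin test function is spherical at every finite place off `T`.** [folklore] -/
theorem isLastRowSphericalAt_thinTestFun (Φinf : (Fin n → InfiniteAdeleRing K) → ℝ)
    {T : Finset (HeightOneSpectrum (𝓞 K))} (m : ℕ) {v : HeightOneSpectrum (𝓞 K)} (hv : v ∉ T) :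
    IsLastRowSphericalAt n K (thinTestFun n K Φinf T m) v := by
  refine ⟨fun c y hc1 hcw hcv _ hy => ?_⟩
  have hfst : (fun i => ((c • y) i).1) = fun i => (y i).1 := by
    funext i
    rw [Pi.smul_apply, smul_eq_mul, show (c * y i).1 = c.1 * (y i).1 from rfl, hc1, one_mul]
  have hsnd : ∀ i w, ((c • y) i).2 w = c.2 w * (y i).2 w := fun i w => rfl
  have hiff : ((fun i => ((c • y) i).2) ∈ thinFiniteBox n K T m) ↔
      ((fun i => (y i).2) ∈ thinFiniteBox n K T m) := by
    rw [mem_thinFiniteBox_iff, mem_thinFiniteBox_iff]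
    refine and_congr (forall_congr' fun i => forall_congr' fun w => ?_)
      (forall_congr' fun w => forall_congr' fun hw => forall_congr' fun i => ?_)
    · rw [hsnd]
      by_cases hw : w = v
      · subst hw
        rw [HeightOneSpectrum.mem_adicCompletionIntegers, HeightOneSpectrum.mem_adicCompletionIntegers,
          map_mul]
        exact ⟨fun _ => hy i, fun h => mul_le_one' hcv h⟩
      · rw [hcw w hw, one_mul]
    · have hwv : w ≠ v := fun h => hv (h ▸ hw)
      rw [hsnd, hcw w hwv, one_mul]
  unfold thinTestFun
  rw [hfst]
  simp only [hiff]

/-! ### The Gaussian thin test function -/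

variable (n K)

/-- **The Gaussian thin test function lies in `piSchwartzBruhat K (Fin n)`.** [folklore] -/
theorem thinTestFun_gauss_mem_piSchwartzBruhat (T : Finset (HeightOneSpectrum (𝓞 K))) (m : ℕ) :
    (fun y => ((thinTestFun n K (gaussArchTestFun n K) T m y : ℝ) : ℂ)) ∈ piSchwartzBruhat K (Fin n) := by
  obtain ⟨Ψ, hΨ⟩ := exists_schwartzMap_gaussArchTestFun n K
  exact ofReal_thinTestFun_mem_piSchwartzBruhat hΨ T m

/-- The Gaussian thin test function is non-negative. [folklore] -/
theorem thinTestFun_gauss_nonneg (T : Finset (HeightOneSpectrum (𝓞 K))) (m : ℕ)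
    (y : Fin n → AdeleRing (𝓞 K) K) : 0 ≤ thinTestFun n K (gaussArchTestFun n K) T m y :=
  thinTestFun_nonneg (fun z => (gaussArchTestFun_pos n K z).le) T m y

/-- The Gaussian thin test function is positive on its (open) box. [folklore] -/
theorem thinTestFun_gauss_pos_of_mem {T : Finset (HeightOneSpectrum (𝓞 K))} {m : ℕ}
    {y : Fin n → AdeleRing (𝓞 K) K} (hy : (fun i => (y i).2) ∈ thinFiniteBox n K T m) :
    0 < thinTestFun n K (gaussArchTestFun n K) T m y := by
  rw [thinTestFun_of_mem hy]
  exact gaussArchTestFun_pos n K _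

variable [MeasurableSpace (AdeleRing (𝓞 K) K)] [BorelSpace (AdeleRing (𝓞 K) K)]

/-- **`∫ Φ dμ > 0` for the Gaussian thin test function** and every additive Haar measure `μ` on `𝔸_Kⁿ`:
`Φ ≥ 0` is integrable and positive on the non-empty open set `{y | y_f ∈ thin box}` (which contains
`e_n`). [folklore] -/
theorem integral_thinTestFun_gauss_pos (T : Finset (HeightOneSpectrum (𝓞 K))) (m : ℕ)
    (μ : Measure (Fin n → AdeleRing (𝓞 K) K)) [μ.IsAddHaarMeasure] :
    0 < ∫ y, thinTestFun n K (gaussArchTestFun n K) T m y ∂μ := by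
  set Φ : (Fin n → AdeleRing (𝓞 K) K) → ℝ := thinTestFun n K (gaussArchTestFun n K) T m with hΦ
  have hintC : Integrable (fun y => ((Φ y : ℝ) : ℂ)) μ :=
    integrable_of_mem_piSchwartzBruhat (ν := μ) (thinTestFun_gauss_mem_piSchwartzBruhat n K T m)
  have hint : Integrable Φ μ := by
    have h := hintC.re
    simpa only [RCLike.re_to_complex, Complex.ofReal_re] using h
  rw [integral_pos_iff_support_of_nonneg (fun y => thinTestFun_gauss_nonneg n K T m y) hint]
  set U : Set (Fin n → AdeleRing (𝓞 K) K) := {y | (fun i => (y i).2) ∈ thinFiniteBox n K T m} with hU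
  have hUo : IsOpen U :=
    (isClopen_thinFiniteBox n K T m).isOpen.preimage
      (continuous_pi fun i => continuous_snd.comp (continuous_apply i))
  set y₀ : Fin n → AdeleRing (𝓞 K) K := fun i => if (i : ℕ) + 1 = n then 1 else 0 with hy₀
  have hU0 : y₀ ∈ U := by
    have : (fun i => (y₀ i).2) = fun i : Fin n =>
        ((if (i : ℕ) + 1 = n then 1 else 0 : FiniteAdeleRing (𝓞 K) K)) := by
      funext i
      simp only [hy₀]
      split_ifs <;> rfl
    change (fun i => (y₀ i).2) ∈ thinFiniteBox n K T m
    rw [this]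
    exact lastBasisVec_mem_thinFiniteBox n K T m
  have hUsupp : U ⊆ Function.support Φ := fun y hy =>
    (thinTestFun_gauss_pos_of_mem n K hy).ne'
  exact (hUo.measure_pos μ ⟨y₀, hU0⟩).trans_le (measure_mono hUsupp)

/-- **`∫ Φ ≠ 0`** for the complexified Gaussian thin test function (the hypothesis of
`CuspidalAutomorphicRepGL.exists_residue_datum`). [folklore] -/
theorem integral_ofReal_thinTestFun_gauss_ne_zero (T : Finset (HeightOneSpectrum (𝓞 K))) (m : ℕ)
    (μ : Measure (Fin n → AdeleRing (𝓞 K) K)) [μ.IsAddHaarMeasure] :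
    ∫ y, ((thinTestFun n K (gaussArchTestFun n K) T m y : ℝ) : ℂ) ∂μ ≠ 0 := by
  rw [integral_complex_ofReal, Complex.ofReal_ne_zero]
  exact (integral_thinTestFun_gauss_pos n K T m μ).ne'

end Thin

end Literature.NumberTheory.Automorphic
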